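import Literature.Computability.AlgebraicComplexity.RectangularExponentAsymptoticRank
import HarnessLib

/-!
# Homogeneity of the rectangular exponents, `ω(ta, tb, tc) = t · ω(a, b, c)`, and the rational
middle exponents `ω(1, p/d, 1)` through the asymptotic rank — proved

Topic `Literature/Computability/AlgebraicComplexity`.  For the rank-form exponents of the tree,
`omegaRect K a b c = inf {β | R(⟨⌈n^a⌉, ⌈n^b⌉, ⌈n^c⌉⟩) = O(n^β)}` (`RectangularExponent.lean`),
the classical homogeneity (Lotti–Romani 1983; Huang–Pan 1998, §2: `ω(ar, br, cr) = r ω(a, b, c)`)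
in the integral scalings `t ∈ ℕ`, `t ≥ 1`, which is all that is needed to express the exponents
`ω(1, κ, 1)` of RATIONAL `κ = p/d` — the quantities bounded in the tables of Vassilevska
Williams–Xu–Xu–Zhou 2024 and Alman–Duan–Vassilevska Williams–Xu–Xu–Zhou 2025 — through honest
tensors: with `advxxz2025_omegaRect_eq_logb_asymptoticRank` (`RectangularExponentAsymptoticRank.lean`,
ADVXXZ §3.4 "`ω(a,b,c) = log_q R̃(⟨q^a,q^b,q^c⟩)`"),

  `ω(1, p/d, 1) = ω(d, p, d) / d = log_q R̃(⟨q^d, q^p, q^d⟩) / d`   (`q ≥ 2`, `d ≥ 1`).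

* `rectDim_pow_natCast` — `⌈(n^t)^a⌉ = ⌈n^{ta}⌉`: the defining rank function of `(ta,tb,tc)` at
  `n` IS that of `(a,b,c)` at `n^t`;
* `rectAdmissibleExponents_nonneg`, `rectAdmissibleExponents_bddBelow` — admissible exponents are
  `≥ 0` (the ranks are `≥ 1`), so `ω(a,b,c)` is a genuine infimum for all `a, b, c`;
* `mul_mem_rectAdmissibleExponents_smul` — `β` admissible for `(a,b,c)` ⇒ `tβ` admissible for
  `(ta,tb,tc)`; `div_mem_rectAdmissibleExponents_of_smul` — `γ ≥ 0` admissible for `(ta,tb,tc)`,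
  `a,b,c ≥ 0` ⇒ `γ/t` admissible for `(a,b,c)` (pad `m` up to `⌈m^{1/t}⌉^t ≤ 2^t m`);
* `omegaRect_smul` — **`ω(ta, tb, tc) = t · ω(a, b, c)`** (`t ∈ ℕ`, `t ≥ 1`, `a, b, c ≥ 0`);
* `omegaRect_one_div_one` — `ω(1, p/d, 1) = ω(d, p, d) / d`, and
  `advxxz2025_omegaRect_one_rat_one` — `ω(1, p/d, 1) = log_q R̃(⟨q^d, q^p, q^d⟩) / d`.

Everything is proved; no definitions, no named facts.

## References

* J. Alman, R. Duan, V. Vassilevska Williams, Y. Xu, Z. Xu, R. Zhou, *More asymmetry yields faster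
  matrix multiplication*, SODA 2025, arXiv:2404.16349, §3.4 (definition of `ω(a,b,c)` by `R̃`; "we
  focus on bounds for `ω(1,κ,1)` for `κ > 0`"). [AlmanDuanVassilevskaWilliamsXuXuZhou2025]
* X. Huang, V. Y. Pan, *Fast rectangular matrix multiplication and applications*, J. Complexity 14
  (1998) 257–299, §2 (homogeneity `ω(ar,br,cr) = r ω(a,b,c)`, after Lotti–Romani 1983).
* F. Le Gall, *Faster algorithms for rectangular matrix multiplication*, FOCS 2012, §2. [LeGall2012]
-/

noncomputable section

open Filter Asymptotics

namespace Literature.Computability.AlgebraicComplexity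

section Homogeneity

variable (K : Type) [Field K]

/-- `⌈(n^t)^a⌉ = ⌈n^{ta}⌉`. [folklore] -/
theorem rectDim_pow_natCast (n t : ℕ) (a : ℝ) : rectDim (n ^ t) a = rectDim n (t * a) := by
  unfold rectDim
  push_cast
  rw [Real.rpow_natCast_mul (Nat.cast_nonneg _)]

/-- `⌈m^a⌉ ≤ ⌈n^a⌉` for `m ≤ n` and `a ≥ 0`. [folklore] -/
theorem rectDim_mono_left {m n : ℕ} (h : m ≤ n) {a : ℝ} (ha : 0 ≤ a) : rectDim m a ≤ rectDim n a :=
  Nat.ceil_mono (Real.rpow_le_rpow (Nat.cast_nonneg _) (by exact_mod_cast h) ha)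

/-- The defining rank function is `≥ 1` from `n = 1` on. [folklore] -/
theorem one_le_tensorRank_matMulTensor_rectDim {n : ℕ} (hn : 1 ≤ n) (a b c : ℝ) :
    1 ≤ tensorRank (matMulTensor K (rectDim n a) (rectDim n b) (rectDim n c)) := by
  haveI : NeZero (rectDim n c) := ⟨by have := one_le_rectDim hn c; omega⟩
  have h := mul_le_tensorRank_matMulTensor_left K (rectDim n a) (rectDim n b) (rectDim n c)
  have h1 : 1 ≤ rectDim n a * rectDim n b := Nat.one_le_iff_ne_zero.2
    (Nat.mul_ne_zero (by have := one_le_rectDim hn a; omega) (by have := one_le_rectDim hn b; omega))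
  exact h1.trans h

/-- **Admissible exponents are non-negative** (the ranks are `≥ 1`, while `C n^β → 0` for
`β < 0`). [folklore] -/
theorem rectAdmissibleExponents_nonneg {a b c β : ℝ} (hβ : β ∈ rectAdmissibleExponents K a b c) :
    0 ≤ β := by
  by_contra hneg
  rw [not_le] at hneg
  obtain ⟨C, hC⟩ := isBigO_iff.1 hβ
  have hev : ∀ᶠ n : ℕ in atTop, (1 : ℝ) ≤ C * (n : ℝ) ^ β := by
    filter_upwards [hC, eventually_ge_atTop 1] with n hn hn1
    rw [Real.norm_of_nonneg (Nat.cast_nonneg _),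
      Real.norm_of_nonneg (Real.rpow_nonneg (Nat.cast_nonneg _) _)] at hn
    exact le_trans (by exact_mod_cast one_le_tensorRank_matMulTensor_rectDim K hn1 a b c) hn
  have hlim : Tendsto (fun n : ℕ => C * (n : ℝ) ^ β) atTop (nhds (C * 0)) := by
    refine Tendsto.const_mul C ?_
    have h1 : Tendsto (fun x : ℝ => x ^ β) atTop (nhds 0) := by
      have := tendsto_rpow_neg_atTop (by linarith : 0 < -β)
      simpa using this
    exact h1.comp tendsto_natCast_atTop_atTop
  rw [mul_zero] at hlim
  obtain ⟨n, hn1, hn2⟩ := (hev.and (hlim.eventually (gt_mem_nhds (by norm_num : (0 : ℝ) < 1)))).exists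
  linarith

/-- `ω(a, b, c)` is a genuine infimum: the admissible exponents are bounded below (by `0`).
[folklore] -/
theorem rectAdmissibleExponents_bddBelow (a b c : ℝ) : BddBelow (rectAdmissibleExponents K a b c) :=
  ⟨0, fun _ hβ => rectAdmissibleExponents_nonneg K hβ⟩

/-- `0 ≤ ω(a, b, c)`. [folklore] -/
theorem omegaRect_nonneg (a b c : ℝ) : 0 ≤ omegaRect K a b c :=
  le_csInf (rectAdmissibleExponents_nonempty K a b c) fun _ hβ => rectAdmissibleExponents_nonneg K hβ

/-- Scaling up: `β` admissible for `(a,b,c)` ⇒ `tβ` admissible for `(ta,tb,tc)` (the rank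
function of `(ta,tb,tc)` at `n` is that of `(a,b,c)` at `n^t`). [folklore] -/
theorem mul_mem_rectAdmissibleExponents_smul {t : ℕ} (ht : 1 ≤ t) {a b c β : ℝ}
    (hβ : β ∈ rectAdmissibleExponents K a b c) :
    (t : ℝ) * β ∈ rectAdmissibleExponents K (t * a) (t * b) (t * c) := by
  obtain ⟨C, hC⟩ := isBigO_iff.1 hβ
  rw [rectAdmissibleExponents, Set.mem_setOf_eq, isBigO_iff]
  refine ⟨C, ?_⟩
  have hT : Tendsto (fun n : ℕ => n ^ t) atTop atTop := tendsto_pow_atTop (by omega)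
  filter_upwards [hT.eventually hC] with n hn
  rw [rectDim_pow_natCast, rectDim_pow_natCast, rectDim_pow_natCast] at hn
  have e : ‖((n ^ t : ℕ) : ℝ) ^ β‖ = ‖(n : ℝ) ^ ((t : ℝ) * β)‖ := by
    push_cast
    rw [Real.rpow_natCast_mul (Nat.cast_nonneg _)]
  rwa [e] at hn

/-- Scaling down: `γ ≥ 0` admissible for `(ta,tb,tc)` with `a, b, c ≥ 0` ⇒ `γ/t` admissible for
`(a,b,c)`: pad `m` up to `n^t`, `n = ⌈m^{1/t}⌉ ≤ 2 m^{1/t}`, so that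
`R(m) ≤ R(n^t) ≤ C n^γ ≤ C 2^γ m^{γ/t}`. [folklore] -/
theorem div_mem_rectAdmissibleExponents_of_smul {t : ℕ} (ht : 1 ≤ t) {a b c γ : ℝ} (ha : 0 ≤ a)
    (hb : 0 ≤ b) (hc : 0 ≤ c) (hγ0 : 0 ≤ γ)
    (hγ : γ ∈ rectAdmissibleExponents K (t * a) (t * b) (t * c)) :
    γ / t ∈ rectAdmissibleExponents K a b c := by
  obtain ⟨C, hC⟩ := isBigO_iff.1 hγ
  obtain ⟨N₀, hN₀⟩ := eventually_atTop.1 hC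
  have ht0 : (t : ℝ) ≠ 0 := by exact_mod_cast (by omega : t ≠ 0)
  have htpos : (0 : ℝ) < t := by exact_mod_cast (by omega : 0 < t)
  rw [rectAdmissibleExponents, Set.mem_setOf_eq, isBigO_iff]
  refine ⟨C * 2 ^ γ, eventually_atTop.2 ⟨max N₀ 1 ^ t, fun m hm => ?_⟩⟩
  have hM1 : 1 ≤ max N₀ 1 := le_max_right _ _
  have hm1 : 1 ≤ m := le_trans (Nat.one_le_pow _ _ hM1) hm
  have hm0 : (0 : ℝ) ≤ m := Nat.cast_nonneg _
  -- `x = m^{1/t}`, `n = ⌈x⌉`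
  set x : ℝ := (m : ℝ) ^ ((t : ℝ)⁻¹) with hx
  have hx0 : 0 ≤ x := Real.rpow_nonneg hm0 _
  have hxt : x ^ t = m := by rw [hx]; exact Real.rpow_inv_natCast_pow hm0 (by omega)
  set n : ℕ := ⌈x⌉₊ with hn
  have hxn : x ≤ n := Nat.le_ceil x
  have hx1 : 1 ≤ x :=
    calc (1 : ℝ) = (1 : ℝ) ^ ((t : ℝ)⁻¹) := (Real.one_rpow _).symm
      _ ≤ x := Real.rpow_le_rpow zero_le_one (by exact_mod_cast hm1) (inv_nonneg.2 htpos.le)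
  have hn1 : 1 ≤ n := by
    have h1 : (1 : ℝ) ≤ n := hx1.trans hxn
    exact_mod_cast h1
  have hn2x : (n : ℝ) ≤ 2 * x := by
    have h1 : (n : ℝ) < x + 1 := Nat.ceil_lt_add_one hx0
    linarith
  -- `m ≤ n^t`
  have hmn : m ≤ n ^ t := by
    have h1 : (m : ℝ) ≤ (n : ℝ) ^ t := by rw [← hxt]; exact pow_le_pow_left₀ hx0 hxn t
    exact_mod_cast h1
  -- `N₀ ≤ n`
  have hN₀n : N₀ ≤ n := by
    have h1 : ((max N₀ 1 : ℕ) : ℝ) ≤ x := by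
      have h2 : (((max N₀ 1 : ℕ) : ℝ) ^ t) ^ ((t : ℝ)⁻¹) ≤ x := by
        rw [hx]
        exact Real.rpow_le_rpow (by positivity) (by exact_mod_cast hm) (inv_nonneg.2 htpos.le)
      rwa [Real.pow_rpow_inv_natCast (Nat.cast_nonneg _) (by omega)] at h2
    have h3 : ((max N₀ 1 : ℕ) : ℝ) ≤ n := h1.trans hxn
    have h4 : max N₀ 1 ≤ n := by exact_mod_cast h3
    exact le_trans (le_max_left _ _) h4
  -- the rank bound at `n`: `R(⟨⌈(n^t)^a⌉, …⟩) = R(⟨⌈n^{ta}⌉, …⟩) ≤ C n^γ`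
  have hRn := hN₀ n hN₀n
  rw [Real.norm_of_nonneg (Nat.cast_nonneg _),
    Real.norm_of_nonneg (Real.rpow_nonneg (Nat.cast_nonneg _) _)] at hRn
  rw [← rectDim_pow_natCast, ← rectDim_pow_natCast, ← rectDim_pow_natCast] at hRn
  have hC0 : 0 ≤ C := by
    by_contra hC
    rw [not_le] at hC
    have h1 : (1 : ℝ) ≤ tensorRank (matMulTensor K (rectDim (n ^ t) a) (rectDim (n ^ t) b)
        (rectDim (n ^ t) c)) := by
      exact_mod_cast one_le_tensorRank_matMulTensor_rectDim K (Nat.one_le_pow _ _ hn1) a b c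
    have h2 : C * (n : ℝ) ^ γ ≤ 0 :=
      mul_nonpos_of_nonpos_of_nonneg hC.le (Real.rpow_nonneg (Nat.cast_nonneg _) _)
    linarith
  -- padding `m ↦ n^t`
  have hpad : tensorRank (matMulTensor K (rectDim m a) (rectDim m b) (rectDim m c)) ≤
      tensorRank (matMulTensor K (rectDim (n ^ t) a) (rectDim (n ^ t) b) (rectDim (n ^ t) c)) :=
    tensorRank_matMulTensor_mono₃ K (rectDim_mono_left hmn ha) (rectDim_mono_left hmn hb)
      (rectDim_mono_left hmn hc)
  -- `n^γ ≤ 2^γ m^{γ/t}`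
  have hnγ : (n : ℝ) ^ γ ≤ 2 ^ γ * (m : ℝ) ^ (γ / t) := by
    calc (n : ℝ) ^ γ ≤ (2 * x) ^ γ := Real.rpow_le_rpow (Nat.cast_nonneg _) hn2x hγ0
      _ = 2 ^ γ * x ^ γ := Real.mul_rpow (by norm_num) hx0
      _ = 2 ^ γ * (m : ℝ) ^ (γ / t) := by
          rw [hx, ← Real.rpow_mul hm0, div_eq_inv_mul]
  rw [Real.norm_of_nonneg (Nat.cast_nonneg _),
    Real.norm_of_nonneg (Real.rpow_nonneg (Nat.cast_nonneg _) _)]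
  calc (tensorRank (matMulTensor K (rectDim m a) (rectDim m b) (rectDim m c)) : ℝ)
      ≤ tensorRank (matMulTensor K (rectDim (n ^ t) a) (rectDim (n ^ t) b) (rectDim (n ^ t) c)) := by
        exact_mod_cast hpad
    _ ≤ C * (n : ℝ) ^ γ := hRn
    _ ≤ C * (2 ^ γ * (m : ℝ) ^ (γ / t)) := mul_le_mul_of_nonneg_left hnγ hC0
    _ = C * 2 ^ γ * (m : ℝ) ^ (γ / t) := by ring

/-- **Homogeneity `ω(ta, tb, tc) = t · ω(a, b, c)`** for `t ∈ ℕ`, `t ≥ 1`, `a, b, c ≥ 0`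
(Lotti–Romani 1983; Huang–Pan 1998, §2). [folklore] -/
theorem omegaRect_smul {t : ℕ} (ht : 1 ≤ t) {a b c : ℝ} (ha : 0 ≤ a) (hb : 0 ≤ b) (hc : 0 ≤ c) :
    omegaRect K (t * a) (t * b) (t * c) = t * omegaRect K a b c := by
  have htpos : (0 : ℝ) < t := by exact_mod_cast (by omega : 0 < t)
  unfold omegaRect
  refine le_antisymm ?_ ?_
  · -- `ω(ta,tb,tc) ≤ t ω(a,b,c)`: for `β` admissible, `tβ` is admissible for the scaled triple
    have h : sInf (rectAdmissibleExponents K (t * a) (t * b) (t * c)) / t ≤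
        sInf (rectAdmissibleExponents K a b c) := by
      refine le_csInf (rectAdmissibleExponents_nonempty K a b c) fun β hβ => ?_
      rw [div_le_iff₀ htpos]
      exact (csInf_le (rectAdmissibleExponents_bddBelow K _ _ _)
        (mul_mem_rectAdmissibleExponents_smul K ht hβ)).trans_eq (mul_comm _ _)
    exact ((div_le_iff₀ htpos).1 h).trans_eq (mul_comm _ _)
  · -- `t ω(a,b,c) ≤ ω(ta,tb,tc)`: for `γ` admissible for the scaled triple, `γ/t` is admissible
    refine le_csInf (rectAdmissibleExponents_nonempty K _ _ _) fun γ hγ => ?_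
    have hγ0 := rectAdmissibleExponents_nonneg K hγ
    have hmem := div_mem_rectAdmissibleExponents_of_smul K ht ha hb hc hγ0 hγ
    have h1 := csInf_le (rectAdmissibleExponents_bddBelow K a b c) hmem
    have h2 := mul_le_mul_of_nonneg_left h1 htpos.le
    have e : (t : ℝ) * (γ / t) = γ := by field_simp
    rwa [e] at h2

/-- **`ω(1, p/d, 1) = ω(d, p, d) / d`** for naturals `p` and `d ≥ 1`. [folklore] -/
theorem omegaRect_one_div_one (p : ℕ) {d : ℕ} (hd : 1 ≤ d) :
    omegaRect K 1 ((p : ℝ) / d) 1 = omegaRect K d p d / d := by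
  have hdpos : (0 : ℝ) < d := by exact_mod_cast (by omega : 0 < d)
  have h := omegaRect_smul K hd (a := 1) (b := (p : ℝ) / d) (c := 1) zero_le_one
    (by positivity) zero_le_one
  have e1 : (d : ℝ) * 1 = d := mul_one _
  have e2 : (d : ℝ) * ((p : ℝ) / d) = p := by field_simp
  rw [e1, e2] at h
  rw [h]
  field_simp

/-- **The rational middle exponents through the asymptotic rank**:
`ω(1, p/d, 1) = log_q R̃(⟨q^d, q^p, q^d⟩) / d` (`q ≥ 2`, `d ≥ 1`) — ADVXXZ §3.4's definition
`ω(a,b,c) = log_q R̃(⟨q^a,q^b,q^c⟩)` made meaningful for the rational `κ` of the tables via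
homogeneity. [cite: AlmanDuanVassilevskaWilliamsXuXuZhou2025, §3.4] -/
theorem advxxz2025_omegaRect_one_rat_one {q : ℕ} (hq : 2 ≤ q) (p : ℕ) {d : ℕ} (hd : 1 ≤ d) :
    omegaRect K 1 ((p : ℝ) / d) 1 =
      Real.logb q (asymptoticRank (matMulTensor K (q ^ d) (q ^ p) (q ^ d))) / d := by
  rw [omegaRect_one_div_one K p hd, advxxz2025_omegaRect_eq_logb_asymptoticRank K hq d p d]

end Homogeneity

end Literature.Computability.AlgebraicComplexity

end
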